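import Summits.KontsevichZagierPeriods.KontsevichZagierPeriods.Theorems.RootDecompZetaThreeFrontierRungFourPreludeP05

/-! # `RootDecompZetaThreeFrontierRungFourPreludeP06` — part 6/14 of the mechanical ≤400-line split of `pre_src.lean` (sha256 ba362a5194d75c20…)
Source: decomp-kz lens-1 g12/g13 rung-4 prelude = Prelude_v3.lean @ba362a51 (Basis22_v1 sections RotFour/Shuffle/ProdFour/GenFb/WordMoves/RungFour/Basis22 + FacetGeneric_v2 §1–§23; critic CLEARED g6 row 330 / g6-20 l.1368); --supports stmt-KontsevichZagierPeriods-27141.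
Split by census-1 g10 `gen/splitlean.py`: scopes re-opened with their `open`/`variable`/`set_option` context; mathematics and declaration order unchanged. -/

set_option linter.dupNamespace false
noncomputable section
namespace Summit.KontsevichZagierPeriods.KontsevichZagierPeriods.Cruxes.GZNormalFormWThree.GZLadder.WordMoves

open Set MeasureTheory MvPolynomial
open Literature.NumberTheory.Transcendental
open Literature.ModelTheory.ExponentialFields
open Summit.KontsevichZagierPeriods.KontsevichZagierPeriods.Cruxes.GZNormalFormWThree.GZLadder.RotFour
open Summit.KontsevichZagierPeriods.KontsevichZagierPeriods.Cruxes.GZNormalFormWThree.GZLadder.Shuffle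
  (topWords topWords_subset_words)

/-! ## §C.1  A map all of whose components are semialgebraic functions is a semialgebraic map -/

/-- Auxiliary step `isSemialgebraicMapOn_of_components` (§C.1): is Semialgebraic Map On of components. [bookkeeping] -/
theorem isSemialgebraicMapOn_of_components {m n : ℕ} {s : Set (Fin m → ℝ)} (hs : IsSemialgebraic ℚ s)
    {f : (Fin m → ℝ) → (Fin n → ℝ)} (hf : ∀ j, IsSemialgebraicFunOn ℚ s (fun x => f x j)) :
    IsSemialgebraicMapOn ℚ s f := by
  rw [isSemialgebraicMapOn_iff]
  let P : Fin m → MvPolynomial (Fin (m + n)) ℚ := fun i => X (Fin.castAdd n i)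
  let Q : Fin n → Fin (m + 1) → MvPolynomial (Fin (m + n)) ℚ :=
    fun j => Fin.snoc (fun i => X (Fin.castAdd n i)) (X (Fin.natAdd m j))
  have hpre : IsSemialgebraic ℚ ((fun z : Fin (m + n) → ℝ => fun i => aeval z (P i)) ⁻¹' s) :=
    hs.preimage_aeval P
  have hG : ∀ j, IsSemialgebraic ℚ ((fun z : Fin (m + n) → ℝ => fun i => aeval z (Q j i)) ⁻¹'
      {w : Fin (m + 1) → ℝ | Fin.init w ∈ s ∧ w (Fin.last m) = f (Fin.init w) j}) :=
    fun j => (isSemialgebraicFunOn_iff.1 (hf j)).preimage_aeval (Q j)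
  have hP : ∀ z : Fin (m + n) → ℝ, (fun i => aeval z (P i)) = fun i => z (Fin.castAdd n i) := by
    intro z; funext i; simp [P]
  have hinit : ∀ (z : Fin (m + n) → ℝ) (j : Fin n),
      Fin.init (fun i => aeval z (Q j i)) = fun i => z (Fin.castAdd n i) := by
    intro z j; funext i; simp [Fin.init, Q]
  have hlast : ∀ (z : Fin (m + n) → ℝ) (j : Fin n), aeval z (Q j (Fin.last m)) = z (Fin.natAdd m j) := by
    intro z j; simp [Q]
  have e : {z : Fin (m + n) → ℝ | (fun i => z (Fin.castAdd n i)) ∈ s ∧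
      (fun j => z (Fin.natAdd m j)) = f (fun i => z (Fin.castAdd n i))} =
      ((fun z : Fin (m + n) → ℝ => fun i => aeval z (P i)) ⁻¹' s) ∩
      ⋂ j ∈ (Finset.univ : Finset (Fin n)), ((fun z : Fin (m + n) → ℝ => fun i => aeval z (Q j i)) ⁻¹'
        {w : Fin (m + 1) → ℝ | Fin.init w ∈ s ∧ w (Fin.last m) = f (Fin.init w) j}) := by
    ext z
    simp only [mem_setOf_eq, mem_inter_iff, mem_preimage, mem_iInter, Finset.mem_univ, true_implies, hP,
      hinit, hlast]
    constructor
    · rintro ⟨h1, h2⟩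
      exact ⟨h1, fun j => ⟨h1, congrFun h2 j⟩⟩
    · rintro ⟨h1, h2⟩
      exact ⟨h1, funext fun j => (h2 j).2⟩
  rw [e]
  exact hpre.inter (IsSemialgebraic.biInter _ _ fun j _ => hG j)

/-! ## §C.2  `ρ` is a semialgebraic map on `Δ₄`; the pullback operators -/

/-- Auxiliary step `simplex_ne` (§C.2): simplex ne. [bookkeeping] -/
theorem simplex_ne {t : Fin 4 → ℝ} (ht : t ∈ KZ.openOrderedSimplex 4) (i : Fin 4) : t i ≠ 0 := (ht.1 i).ne'

/-- Auxiliary step `isSemialgebraicMapOn_rot4` (§C.2): is Semialgebraic Map On rot4. [bookkeeping] -/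
theorem isSemialgebraicMapOn_rot4 : IsSemialgebraicMapOn ℚ (KZ.openOrderedSimplex 4) rot4 := by
  have hS := KZ.isSemialgebraic_openOrderedSimplex 4
  refine isSemialgebraicMapOn_of_components hS fun j => ?_
  fin_cases j
  · exact (isSemialgebraicFunOn_aeval hS (C 1 - X 3 : MvPolynomial (Fin 4) ℚ)).congr fun t _ => by
      simp [rot4_zero]
  · exact (isSemialgebraicFunOn_aeval_div_aeval hS (X 0 - X 3 : MvPolynomial (Fin 4) ℚ) (X 0)
      fun t ht => by simpa using simplex_ne ht 0).congr fun t ht => by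
        have := simplex_ne ht 0
        simp [rot4_one]
        field_simp
  · exact (isSemialgebraicFunOn_aeval_div_aeval hS (X 1 - X 3 : MvPolynomial (Fin 4) ℚ) (X 1)
      fun t ht => by simpa using simplex_ne ht 1).congr fun t ht => by
        have := simplex_ne ht 1
        simp [rot4_two]
        field_simp
  · exact (isSemialgebraicFunOn_aeval_div_aeval hS (X 2 - X 3 : MvPolynomial (Fin 4) ℚ) (X 2)
      fun t ht => by simpa using simplex_ne ht 2).congr fun t ht => by
        have := simplex_ne ht 2
        simp [rot4_three]
        field_simp

/-- pullback of an integrand along the rotation: `(ρ^* f)(t) = f(ρ t)·|det Dρ(t)|`. -/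
def rotFun (f : (Fin 4 → ℝ) → ℝ) (t : Fin 4 → ℝ) : ℝ := f (rot4 t) * (t 3 ^ 3 / (t 0 * t 1 * t 2) ^ 2)

/-- pullback along the reflection (Jacobian `1`). -/
def reflFun (f : (Fin 4 → ℝ) → ℝ) (t : Fin 4 → ℝ) : ℝ := f (refl4 t)

/-- Auxiliary step `isSemialgebraicFunOn_jac` (§C.2): is Semialgebraic Fun On jac. [bookkeeping] -/
theorem isSemialgebraicFunOn_jac :
    IsSemialgebraicFunOn ℚ (KZ.openOrderedSimplex 4) (fun t : Fin 4 → ℝ => t 3 ^ 3 / (t 0 * t 1 * t 2) ^ 2) :=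
  (isSemialgebraicFunOn_aeval_div_aeval (KZ.isSemialgebraic_openOrderedSimplex 4)
    (X 3 ^ 3 : MvPolynomial (Fin 4) ℚ) ((X 0 * X 1 * X 2) ^ 2) fun t ht => by
      have h0 := simplex_ne ht 0
      have h1 := simplex_ne ht 1
      have h2 := simplex_ne ht 2
      simpa using ⟨⟨h0, h1⟩, h2⟩).congr fun t _ => by simp

/-- Auxiliary step `isSemialgebraicFunOn_rotFun` (§C.2): is Semialgebraic Fun On rot Fun. [bookkeeping] -/
theorem isSemialgebraicFunOn_rotFun {f : (Fin 4 → ℝ) → ℝ} (hf : IsSemialgebraicFunOn ℚ (KZ.openOrderedSimplex 4) f) :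
    IsSemialgebraicFunOn ℚ (KZ.openOrderedSimplex 4) (rotFun f) := by
  have h1 : IsSemialgebraicFunOn ℚ (KZ.openOrderedSimplex 4) (f ∘ rot4) :=
    IsSemialgebraicFunOn.comp_isSemialgebraicMapOn_holds hf isSemialgebraicMapOn_rot4 fun t ht => rot4_mem ht
  exact (IsSemialgebraicFunOn.mul_holds h1 isSemialgebraicFunOn_jac).congr fun t _ => by
    simp [rotFun, Function.comp]

/-- Auxiliary step `isSemialgebraicFunOn_reflFun` (§C.2): is Semialgebraic Fun On refl Fun. [bookkeeping] -/
theorem isSemialgebraicFunOn_reflFun {f : (Fin 4 → ℝ) → ℝ} (hf : IsSemialgebraicFunOn ℚ (KZ.openOrderedSimplex 4) f) :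
    IsSemialgebraicFunOn ℚ (KZ.openOrderedSimplex 4) (reflFun f) :=
  IsSemialgebraicFunOn.comp_isSemialgebraicMapOn_holds hf
    (isSemialgebraicMapOn_refl4 (KZ.isSemialgebraic_openOrderedSimplex 4)) fun _ ht => refl4_mem ht

/-- integrability is transported along `ρ` (through the two polynomial charts `Ψ_A, Ψ_B : P → Δ₄`). -/
theorem integrableOn_rotFun {f : (Fin 4 → ℝ) → ℝ} (hf : IntegrableOn f (KZ.openOrderedSimplex 4)) :
    IntegrableOn (rotFun f) (KZ.openOrderedSimplex 4) := by
  have hB := (integrableOn_image_iff_integrableOn_abs_det_fderiv_smul (μ := volume) measurableSet_rtDom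
      (fun x _ => (hasFDerivAt_rtB x).hasFDerivWithinAt) injOn_rtB f).1 (by rw [image_rtB]; exact hf)
  have hA := (integrableOn_image_iff_integrableOn_abs_det_fderiv_smul (μ := volume) measurableSet_rtDom
      (fun x _ => (hasFDerivAt_rtA x).hasFDerivWithinAt) injOn_rtA (rotFun f)).2
    (hB.congr_fun (fun p hp => ?_) measurableSet_rtDom)
  · rwa [image_rtA] at hA
  obtain ⟨ha, hb, hc, hd, ha', hb', hc', hd'⟩ := rtDom_facts hp
  simp only [smul_eq_mul, abs_det_rtAL hp, abs_det_rtBL hp, rotFun, rot4_rtA hp, rtA_zero, rtA_one, rtA_two,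
    rtA_three]
  field_simp

/-- Auxiliary step `integrableOn_reflFun` (§C.2): integrable On refl Fun. [bookkeeping] -/
theorem integrableOn_reflFun {f : (Fin 4 → ℝ) → ℝ} (hf : IntegrableOn f (KZ.openOrderedSimplex 4)) :
    IntegrableOn (reflFun f) (KZ.openOrderedSimplex 4) := by
  have h := (integrableOn_image_iff_integrableOn_abs_det_fderiv_smul (μ := volume)
      (KZ.measurableSet_openOrderedSimplex 4) (fun x _ => (hasFDerivAt_refl4 x).hasFDerivWithinAt)
      (injOn_refl4 _) (reflFun f)).2
    (hf.congr_fun (fun t _ => by simp [reflFun, refl4_refl4, abs_det_reflL]) (KZ.measurableSet_openOrderedSimplex 4))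
  rwa [image_refl4] at h

/-! ## §C.3  `GoodS f`: `[Δ₄, c·f]` exists and is congruent into `words 4`, for every `c : ℚ` -/

/-- the invariant pushed through the dihedral moves -/
def GoodS (f : (Fin 4 → ℝ) → ℝ) : Prop :=
  IsSemialgebraicFunOn ℚ (KZ.openOrderedSimplex 4) f ∧
    ∀ c : ℚ, ∃ r : KZ.IntegralRep 4, r.domain = KZ.openOrderedSimplex 4 ∧
      EqOn r.integrand (fun t => (c : ℝ) * f t) (KZ.openOrderedSimplex 4) ∧ CongInto (words 4) (KZ.of r)

/-- Auxiliary step `integrableOn` (§C.3): integrable On. [bookkeeping] -/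
theorem GoodS.integrableOn {f : (Fin 4 → ℝ) → ℝ} (h : GoodS f) : IntegrableOn f (KZ.openOrderedSimplex 4) := by
  obtain ⟨r, hrd, hri, -⟩ := h.2 1
  have hr := r.integrableOn
  rw [hrd] at hr
  refine hr.congr_fun (fun t ht => ?_) (KZ.measurableSet_openOrderedSimplex 4)
  rw [hri ht]
  simp

/-- Auxiliary step `isSemialgebraicFunOn_const_mul` (§C.3): is Semialgebraic Fun On const mul. [bookkeeping] -/
theorem isSemialgebraicFunOn_const_mul {f : (Fin 4 → ℝ) → ℝ} (hf : IsSemialgebraicFunOn ℚ (KZ.openOrderedSimplex 4) f)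
    (c : ℚ) : IsSemialgebraicFunOn ℚ (KZ.openOrderedSimplex 4) (fun t => (c : ℝ) * f t) := by
  have hc : IsSemialgebraicFunOn ℚ (KZ.openOrderedSimplex 4) (fun _ : Fin 4 → ℝ => (c : ℝ)) :=
    (isSemialgebraicFunOn_aeval (KZ.isSemialgebraic_openOrderedSimplex 4) (C c : MvPolynomial (Fin 4) ℚ)).congr
      fun t _ => by simp
  exact (IsSemialgebraicFunOn.mul_holds hc hf).congr fun t _ => by simp

/-- `[Δ₄, c·g]` for a semialgebraic integrable `g`. -/
def mkRep (g : (Fin 4 → ℝ) → ℝ) (hsa : IsSemialgebraicFunOn ℚ (KZ.openOrderedSimplex 4) g)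
    (hint : IntegrableOn g (KZ.openOrderedSimplex 4)) (c : ℚ) : KZ.IntegralRep 4 where
  domain := KZ.openOrderedSimplex 4
  integrand := fun t => (c : ℝ) * g t
  isSemialgebraic_domain := KZ.isSemialgebraic_openOrderedSimplex 4
  isSemialgebraicFunOn_integrand := isSemialgebraicFunOn_const_mul hsa c
  integrableOn := hint.const_mul (c : ℝ)

/-- Auxiliary step `congInto_self'` (§C.3): cong Into self'. [bookkeeping] -/
theorem congInto_self' {S : Set KZ.FormalRep} {x : KZ.FormalRep} (hx : x ∈ S) : CongInto S x :=
  ⟨x, AddSubgroup.subset_closure hx, by rw [sub_self]; exact KZ.relations.zero_mem⟩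

/-- Auxiliary step `congInto_of_sub_mem'` (§C.3): cong Into of sub mem'. [bookkeeping] -/
private theorem congInto_of_sub_mem' {T : Set KZ.FormalRep} {x m : KZ.FormalRep} (h : x - m ∈ KZ.relations)
    (hm : CongInto T m) : CongInto T x := by
  obtain ⟨m', hm', h'⟩ := hm
  refine ⟨m', hm', ?_⟩
  have key := add_mem h h'
  rwa [sub_add_sub_cancel] at key

/-- **the rotation preserves `GoodS`** (`Rot4_v1.rot_rel`). -/
theorem goodS_rot {f : (Fin 4 → ℝ) → ℝ} (h : GoodS f) : GoodS (rotFun f) := by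
  have hsa := isSemialgebraicFunOn_rotFun h.1
  have hint : IntegrableOn (rotFun f) (KZ.openOrderedSimplex 4) := integrableOn_rotFun h.integrableOn
  refine ⟨hsa, fun c => ?_⟩
  obtain ⟨r, hrd, hri, hrT⟩ := h.2 c
  refine ⟨mkRep (rotFun f) hsa hint c, rfl, fun t _ => rfl, ?_⟩
  have hrel : KZ.of (mkRep (rotFun f) hsa hint c) - KZ.of r ∈ KZ.relations := by
    refine rot_rel _ r rfl hrd fun t ht => ?_
    have e : r.integrand (rot4 t) = (c : ℝ) * f (rot4 t) := hri (rot4_mem ht)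
    show (c : ℝ) * (f (rot4 t) * (t 3 ^ 3 / (t 0 * t 1 * t 2) ^ 2)) = r.integrand (rot4 t) * (t 3 ^ 3 / (t 0 * t 1 * t 2) ^ 2)
    rw [e]
    ring
  exact congInto_of_sub_mem' hrel hrT

/-- **the reflection preserves `GoodS`** (`Rot4_v1.refl_rel`). -/
theorem goodS_refl {f : (Fin 4 → ℝ) → ℝ} (h : GoodS f) : GoodS (reflFun f) := by
  have hsa := isSemialgebraicFunOn_reflFun h.1
  have hint : IntegrableOn (reflFun f) (KZ.openOrderedSimplex 4) := integrableOn_reflFun h.integrableOn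
  refine ⟨hsa, fun c => ?_⟩
  obtain ⟨r, hrd, hri, hrT⟩ := h.2 c
  refine ⟨mkRep (reflFun f) hsa hint c, rfl, fun t _ => rfl, ?_⟩
  have hrel : KZ.of (mkRep (reflFun f) hsa hint c) - KZ.of r ∈ KZ.relations := by
    refine refl_rel _ r rfl hrd fun t ht => ?_
    have e : r.integrand (refl4 t) = (c : ℝ) * f (refl4 t) := hri (refl4_mem ht)
    show (c : ℝ) * f (refl4 t) = r.integrand (refl4 t)
    rw [e]
  exact congInto_of_sub_mem' hrel hrT

/-- Auxiliary step `goodS_iterate` (§C.3): good S iterate. [bookkeeping] -/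
theorem goodS_iterate {f : (Fin 4 → ℝ) → ℝ} (h : GoodS f) (m : ℕ) : GoodS (rotFun^[m] f) := by
  induction m with
  | zero => simpa using h
  | succ m ih =>
    rw [Function.iterate_succ_apply']
    exact goodS_rot ih

/-! ## §C.4  The word forms -/

/-- the word form `ω_ε = ∏ᵢ ω_{εᵢ}(tᵢ)`, `ω_false(x) = 1/x`, `ω_true(x) = 1/(1-x)`. -/
def wordF (ε : Fin 4 → Bool) (t : Fin 4 → ℝ) : ℝ := ∏ i, if ε i then 1 / (1 - t i) else 1 / t i

/-- Auxiliary step `isSemialgebraicFunOn_letter` (§C.4): is Semialgebraic Fun On letter. [bookkeeping] -/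
theorem isSemialgebraicFunOn_letter (i : Fin 4) (b : Bool) :
    IsSemialgebraicFunOn ℚ (KZ.openOrderedSimplex 4) (fun t : Fin 4 → ℝ => if b then 1 / (1 - t i) else 1 / t i) := by
  have hS := KZ.isSemialgebraic_openOrderedSimplex 4
  cases b
  · exact (isSemialgebraicFunOn_aeval_div_aeval hS (C 1 : MvPolynomial (Fin 4) ℚ) (X i)
      fun t ht => by simpa using simplex_ne ht i).congr fun t _ => by simp
  · exact (isSemialgebraicFunOn_aeval_div_aeval hS (C 1 : MvPolynomial (Fin 4) ℚ) (C 1 - X i)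
      fun t ht => by
        have : t i < 1 := ht.2.1 i
        have : (1 : ℝ) - t i ≠ 0 := by linarith
        simpa using this).congr fun t _ => by simp

/-- Auxiliary step `isSemialgebraicFunOn_wordF` (§C.4): is Semialgebraic Fun On word F. [bookkeeping] -/
theorem isSemialgebraicFunOn_wordF (ε : Fin 4 → Bool) :
    IsSemialgebraicFunOn ℚ (KZ.openOrderedSimplex 4) (wordF ε) :=
  (IsSemialgebraicFunOn.mul_holds (IsSemialgebraicFunOn.mul_holds (IsSemialgebraicFunOn.mul_holds
    (isSemialgebraicFunOn_letter 0 (ε 0)) (isSemialgebraicFunOn_letter 1 (ε 1))) (isSemialgebraicFunOn_letter 2 (ε 2)))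
    (isSemialgebraicFunOn_letter 3 (ε 3))).congr fun t _ => by
      simp only [wordF, Fin.prod_univ_four, Pi.mul_apply]

/-- a `GoodS` word: the base of the induction (the word representation itself lies in `topWords 4 ⊆ words 4`). -/
theorem goodS_wordF (ε : Fin 4 → Bool) (hint : IntegrableOn (wordF ε) (KZ.openOrderedSimplex 4)) : GoodS (wordF ε) := by
  refine ⟨isSemialgebraicFunOn_wordF ε, fun c => ⟨mkRep (wordF ε) (isSemialgebraicFunOn_wordF ε) hint c, rfl,
    fun t _ => rfl, congInto_self' (topWords_subset_words 4 ?_)⟩⟩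
  exact ⟨ε, c, mkRep (wordF ε) (isSemialgebraicFunOn_wordF ε) hint c, rfl, fun t _ => rfl, rfl⟩

/-! ## §C.5  The three convergent weight-4 words are integrable (Literature fact `KZ.mzvIntegrand_integrableOn_holds`) -/

/-- Auxiliary definition `w0001` (§C.5): w0001. [bookkeeping] -/
def w0001 : Fin 4 → Bool := ![false, false, false, true]
/-- Auxiliary definition `w0011` (§C.5): w0011. [bookkeeping] -/
def w0011 : Fin 4 → Bool := ![false, false, true, true]
/-- Auxiliary definition `w0101` (§C.5): w0101. [bookkeeping] -/
def w0101 : Fin 4 → Bool := ![false, true, false, true]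

/-- Auxiliary step `isAdmissible_4` (§C.5): is Admissible 4. [bookkeeping] -/
theorem isAdmissible_4 : MZV.IsAdmissible [4] := ⟨fun i hi => by simp at hi; omega, fun _ => by simp⟩
/-- Auxiliary step `isAdmissible_31` (§C.5): is Admissible 31. [bookkeeping] -/
private theorem isAdmissible_31 : MZV.IsAdmissible [3, 1] := ⟨fun i hi => by simp at hi; omega, fun _ => by simp⟩
/-- Auxiliary step `isAdmissible_22` (§C.5): is Admissible 22. [bookkeeping] -/
private theorem isAdmissible_22 : MZV.IsAdmissible [2, 2] := ⟨fun i hi => by simp at hi; omega, fun _ => by simp⟩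

/-- Auxiliary step `integrableOn_w0001` (§C.5): integrable On w0001. [bookkeeping] -/
theorem integrableOn_w0001 : IntegrableOn (wordF w0001) (KZ.openOrderedSimplex 4) := by
  have h : IntegrableOn (fun a : Fin 4 → ℝ => ∏ i : Fin 4, KZ.mzvForm ((MZV.binaryWord [4]).getD i false) (a i))
      (KZ.openOrderedSimplex 4) volume := KZ.mzvIntegrand_integrableOn_holds [4] isAdmissible_4
  refine h.congr_fun (fun a _ => ?_) (KZ.measurableSet_openOrderedSimplex 4)
  simp [wordF, w0001, Fin.prod_univ_four, MZV.binaryWord, KZ.mzvForm, List.getD]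

/-- Auxiliary step `integrableOn_w0011` (§C.5): integrable On w0011. [bookkeeping] -/
theorem integrableOn_w0011 : IntegrableOn (wordF w0011) (KZ.openOrderedSimplex 4) := by
  have h : IntegrableOn (fun a : Fin 4 → ℝ => ∏ i : Fin 4, KZ.mzvForm ((MZV.binaryWord [3, 1]).getD i false) (a i))
      (KZ.openOrderedSimplex 4) volume := KZ.mzvIntegrand_integrableOn_holds [3, 1] isAdmissible_31
  refine h.congr_fun (fun a _ => ?_) (KZ.measurableSet_openOrderedSimplex 4)
  simp [wordF, w0011, Fin.prod_univ_four, MZV.binaryWord, KZ.mzvForm, List.getD]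

/-- Auxiliary step `integrableOn_w0101` (§C.5): integrable On w0101. [bookkeeping] -/
theorem integrableOn_w0101 : IntegrableOn (wordF w0101) (KZ.openOrderedSimplex 4) := by
  have h : IntegrableOn (fun a : Fin 4 → ℝ => ∏ i : Fin 4, KZ.mzvForm ((MZV.binaryWord [2, 2]).getD i false) (a i))
      (KZ.openOrderedSimplex 4) volume := KZ.mzvIntegrand_integrableOn_holds [2, 2] isAdmissible_22
  refine h.congr_fun (fun a _ => ?_) (KZ.measurableSet_openOrderedSimplex 4)
  simp [wordF, w0101, Fin.prod_univ_four, MZV.binaryWord, KZ.mzvForm, List.getD]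

/-! ## §C.6  Every dihedral image of the three words is a move into `words 4` -/

/-- the dihedral image `(ρ^m ∘ δ^e)^* ω_ε` of a word form: index `2m + e` of RUNG4 §19 / `exp/k4_certificate_data_rot4.json`. -/
def gen (ε : Fin 4 → Bool) (m : ℕ) (e : Bool) : (Fin 4 → ℝ) → ℝ :=
  if e then reflFun (rotFun^[m] (wordF ε)) else rotFun^[m] (wordF ε)

/-- Auxiliary step `goodS_gen` (§C.6): good S gen. [bookkeeping] -/
theorem goodS_gen {ε : Fin 4 → Bool} (hint : IntegrableOn (wordF ε) (KZ.openOrderedSimplex 4)) (m : ℕ) (e : Bool) :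
    GoodS (gen ε m e) := by
  cases e
  · simpa [gen] using goodS_iterate (goodS_wordF ε hint) m
  · simpa [gen] using goodS_refl (goodS_iterate (goodS_wordF ε hint) m)

/-- **THE 21 WORD-IMAGE BASIS MOVES** (and all other dihedral images): for each of the three convergent words
`w ∈ {0001, 0011, 0101}`, every `m`, `e` and every `c : ℚ`, the representation `[Δ₄, c·(ρ^m δ^e)^* ω_w]` exists and is
congruent modulo the KZ moves into `words 4`. -/
theorem basisMove_word (ε : Fin 4 → Bool) (hε : ε = w0001 ∨ ε = w0011 ∨ ε = w0101) (m : ℕ) (e : Bool) (c : ℚ) :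
    ∃ r : KZ.IntegralRep 4, r.domain = KZ.openOrderedSimplex 4 ∧
      EqOn r.integrand (fun t => (c : ℝ) * gen ε m e t) (KZ.openOrderedSimplex 4) ∧ CongInto (words 4) (KZ.of r) := by
  have hint : IntegrableOn (wordF ε) (KZ.openOrderedSimplex 4) := by
    rcases hε with rfl | rfl | rfl
    exacts [integrableOn_w0001, integrableOn_w0011, integrableOn_w0101]
  exact (goodS_gen hint m e).2 c

end Summit.KontsevichZagierPeriods.KontsevichZagierPeriods.Cruxes.GZNormalFormWThree.GZLadder.WordMoves

namespace Summit.KontsevichZagierPeriods.KontsevichZagierPeriods.Cruxes.GZNormalFormWThree.GZLadder.RungFour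

open Set MeasureTheory Literature.NumberTheory.Transcendental
open Summit.KontsevichZagierPeriods.RootDecompZetaThreeFrontier
open Summit.KontsevichZagierPeriods.KontsevichZagierPeriods.Theorems.RootDecompZetaThreeFrontierWordEdge (GZNormalFormW)

/-! ## §0 generic congruence bookkeeping (as in `GZLadder.RungThree`, §48) -/

/-- Auxiliary step `words_mono` (§0): words mono. [bookkeeping] -/
private theorem words_mono {k K : ℕ} (h : k ≤ K) : words k ⊆ words K := by
  rintro x ⟨w, ε, q, s, hw, hd, hi, rfl⟩
  exact ⟨w, ε, q, s, hw.trans h, hd, hi, rfl⟩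

/-- Auxiliary step `congInto_mono` (§0): cong Into mono. [bookkeeping] -/
private theorem congInto_mono {S T : Set KZ.FormalRep} (h : S ⊆ T) {x : KZ.FormalRep} (hx : CongInto S x) :
    CongInto T x := by
  obtain ⟨m, hm, hr⟩ := hx
  exact ⟨m, AddSubgroup.closure_mono h hm, hr⟩

/-- Auxiliary step `congInto_self` (§0): cong Into self. [bookkeeping] -/
theorem congInto_self {S : Set KZ.FormalRep} {x : KZ.FormalRep} (hx : x ∈ S) : CongInto S x :=
  ⟨x, AddSubgroup.subset_closure hx, by simp⟩

/-- if every generator of `S` is congruent into `closure T`, so is every element of `closure S` -/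
private theorem congInto_of_mem_closure {S T : Set KZ.FormalRep} (hS : ∀ x ∈ S, CongInto T x) {c : KZ.FormalRep}
    (hc : c ∈ AddSubgroup.closure S) : CongInto T c := by
  induction hc using AddSubgroup.closure_induction with
  | mem x hx => exact hS x hx
  | zero => exact ⟨0, zero_mem _, by simp⟩
  | add x y _ _ ihx ihy =>
    obtain ⟨m₁, hm₁, h₁⟩ := ihx
    obtain ⟨m₂, hm₂, h₂⟩ := ihy
    refine ⟨m₁ + m₂, add_mem hm₁ hm₂, ?_⟩
    have key := add_mem h₁ h₂
    rwa [show x - m₁ + (y - m₂) = x + y - (m₁ + m₂) by abel] at key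
  | neg x _ ih =>
    obtain ⟨m, hm, h⟩ := ih
    refine ⟨-m, neg_mem hm, ?_⟩
    have key := neg_mem h
    rwa [show -(x - m) = -x - -m by abel] at key

/-- transitivity: `x ≡ m` and `m` congruent into `closure T` -/
private theorem congInto_of_sub_mem {T : Set KZ.FormalRep} {x m : KZ.FormalRep} (h : x - m ∈ KZ.relations)
    (hm : CongInto T m) : CongInto T x := by
  obtain ⟨m', hm', h'⟩ := hm
  refine ⟨m', hm', ?_⟩
  have key := add_mem h h'
  rwa [sub_add_sub_cancel] at key

/-- change of generators: `CongInto S x` and every generator of `S` congruent into `T` -/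
theorem congInto_trans {S T : Set KZ.FormalRep} (hS : ∀ y ∈ S, CongInto T y) {x : KZ.FormalRep}
    (hx : CongInto S x) : CongInto T x := by
  obtain ⟨m, hm, hrel⟩ := hx
  exact congInto_of_sub_mem hrel (congInto_of_mem_closure hS hm)

/-! ## §1 The ladder as slices -/

/-- **the rung-`k` SLICE** of the weight–dimension ladder: every genus-zero datum of dimension exactly `k` is
congruent, modulo the KZ moves, to a `ℤ`-combination of word integrals of weight `≤ k`. -/
def GZSlice (k : ℕ) : Prop := ∀ r : KZ.IntegralRep k, IsGZ k r → CongInto (words k) (KZ.of r)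

end Summit.KontsevichZagierPeriods.KontsevichZagierPeriods.Cruxes.GZNormalFormWThree.GZLadder.RungFour
end
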